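import Summits.CriticalPhenomena.PercolationContinuityZ3.Theorems.PercNearOneGluingNoHeavyLowerTailSahiJuntaSlotExtension

/-!
# `NoHeavyLowerTail` (crux stmt-CriticalPhenomena-4575), Sahi / Kahn positivity: TRANSPORT CERTIFICATES for a junta first slot

Support file (cell `prim-l12`, seat P3, gen 4; `--supports stmt-CriticalPhenomena-4575`).  No `sorry`, no named facts, standard axioms.  New mathematics.

Setting: `μ_p` the product weight on `2^ι`, `e : Fin k ↪ ι` a block of coordinates `A = range e`, `H ⊆ 2^ι` an increasing event determined by `A`
(equivalently an up-set `H_k ⊆ 2^{Fin k}` of PATTERNS), `U, V ⊆ 2^ι` ARBITRARY increasing events.  Target: Kahn's Conjecture 5 / Sahi's `C₃`,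
`E₃(1_H, 1_U, 1_V) ≥ 0`.

THE IDENTITY (`sahiE_three_eq_cubeForm_add`).  With the outer sections `f(S) = μ(U | A-pattern S)`, `g`, `h(S) = μ(U ∩ V | S)` and the outer covariances
`c(S) = h(S) − f(S)g(S) ≥ 0` (Harris outside `A`), `θ = μ(H)`:
   `E₃(1_H,1_U,1_V) = E₃^{cube}(1_{H_k}; f, g) + Σ_S w(S)(2·1_{H_k}(S) − θ) c(S)`,
where `E₃^{cube}` is Sahi's trilinear form on the pattern cube `2^{Fin k}` and `w` its product weight.  The `c`-coefficient is `2 − θ > 0` on `H_k`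
and `−θ < 0` off `H_k`.

THE TRANSPORT (`sahiE_three_nonneg_of_transportCert`).  Since `h = fg + c` is increasing, `c(S) ≤ c(T) + f(T)g(T) − f(S)g(S)` for `S ⊆ T`: a
nonnegative kernel `Π(S,T)` supported on `{S ⊆ T, S ∉ H_k, T ∈ H_k}` with row sums `θ·w(S)` moves the negative `c`-mass up into `H_k`; if the
column sums stay below `(2−θ)w(T)` what remains is the BILINEAR form `B_Π(f,g) = E₃^{cube}(1_{H_k};f,g) − Σ Π(S,T)(f(T)g(T) − f(S)g(S))` in the
increasing nonnegative pattern functions `f, g`, which is nonnegative as soon as it is on pairs of up-set indicators (`cone_of_upperSet`, a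
layer-cake induction).  On indicators `B_Π` is the finite TRANSPORT CONDITION
   `(TC)  Σ_{S ∉ H_k} Σ_{T ∈ 𝒳 ∩ 𝒵} Π(S,T) ≤ (2−θ)[w(𝒳∩𝒵) − w(𝒳)w(𝒵) − w(H_kᶜ ∩ 𝒳 ∩ 𝒵)] + w(𝒳)w(H_kᶜ ∩ 𝒵) + w(𝒵)w(H_kᶜ ∩ 𝒳)`
for all up-sets `𝒳, 𝒵` of the pattern cube — `2^{2^k}`-many pairs, e.g. `210` unordered pairs for `k = 3` (against `160 000` configuration pairs
for the two-configuration certificates of `…SahiJuntaSlotExtension`).  A certificate `Π` at `p|_A` therefore proves `E₃(1_H,1_U,1_V) ≥ 0` for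
ALL increasing `U, V` in EVERY dimension.
READING: `ρ = Π(H_kᶜ, ·)/(θ(1−θ))` is a probability on `H_k` squeezed between `μ(·|H_kᶜ)` and `μ(·|H_k)` in the stochastic order plus
"independence cuts"; for a hitting event the first-open-coordinate law is such a `ρ` (the certificate behind `…SahiHittingSlot`); for the two
`|A| = 3` types not covered before (`a ∨ bc` and majority) explicit polynomial certificates exist (companion files), giving Kahn's conjecture
whenever one slot depends on at most three coordinates. [this work]
-/

noncomputable section

open scoped Classical

namespace Summit.CriticalPhenomena.PercolationContinuityZ3.Theorems

namespace SahiTransportCert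

open Finset
open SahiHittingSlot
open Literature.Combinatorics.Sahi2008
open Literature.Probability.Percolation (DeterminedBy determinedBy_iff)
open Literature.Probability.Percolation.BHK2006 (weight weight_nonneg harris blockFubini ind_inter)
open Literature.Probability.Percolation.DecisionTree (ind ind_of_mem ind_of_not_mem ind_nonneg)

variable {ι : Type} [Fintype ι] {k : ℕ}

/-! ### Planting a pattern on a block of coordinates -/

/-- The configuration `ω` with its `range e`-part replaced by the pattern `S ⊆ Fin k`. [this work] -/
def plant (e : Fin k ↪ ι) (S : Set (Fin k)) (ω : Set ι) : Set ι := Set.ite (Set.range e) (e '' S) ω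

/-- The OUTER SECTION of an event at a pattern: `{ω | plant S ω ∈ X}`. [this work] -/
def osec (e : Fin k ↪ ι) (S : Set (Fin k)) (X : Set (Set ι)) : Set (Set ι) := {ω | plant e S ω ∈ X}

/-- The pattern event of an `A`-determined event: `H_k = {S | e(S) ∈ H}`. [this work] -/
def pat (e : Fin k ↪ ι) (H : Set (Set ι)) : Set (Set (Fin k)) := {S | (e '' S : Set ι) ∈ H}

/-- The parameters on the block. [this work] -/
def pk (e : Fin k ↪ ι) (p : ι → unitInterval) : Fin k → unitInterval := fun i => p (e i)

omit [Fintype ι] in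
/-- Membership in `osec`. [this work] -/
theorem mem_osec {e : Fin k ↪ ι} {S : Set (Fin k)} {X : Set (Set ι)} {ω : Set ι} : ω ∈ osec e S X ↔ plant e S ω ∈ X := Iff.rfl

omit [Fintype ι] in
/-- Membership in `pat`. [this work] -/
theorem mem_pat {e : Fin k ↪ ι} {H : Set (Set ι)} {S : Set (Fin k)} : S ∈ pat e H ↔ (e '' S : Set ι) ∈ H := Iff.rfl

omit [Fintype ι] in
/-- The block part of a planted configuration. [this work] -/
theorem plant_inter_range (e : Fin k ↪ ι) (S : Set (Fin k)) (ω : Set ι) : plant e S ω ∩ Set.range e = e '' S := by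
  rw [plant, Set.ite_inter_self]
  exact Set.inter_eq_left.2 (Set.image_subset_range _ _)

omit [Fintype ι] in
/-- `plant` is monotone in the outside configuration. [this work] -/
theorem plant_mono_right (e : Fin k ↪ ι) (S : Set (Fin k)) {ω ω' : Set ι} (h : ω ⊆ ω') : plant e S ω ⊆ plant e S ω' :=
  Set.ite_mono _ le_rfl h

omit [Fintype ι] in
/-- `plant` is monotone in the pattern. [this work] -/
theorem plant_mono_left (e : Fin k ↪ ι) {S T : Set (Fin k)} (h : S ⊆ T) (ω : Set ι) : plant e S ω ⊆ plant e T ω :=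
  Set.ite_mono _ (Set.image_mono h) le_rfl

omit [Fintype ι] in
/-- Outer sections of increasing events are increasing. [this work] -/
theorem isUpperSet_osec (e : Fin k ↪ ι) (S : Set (Fin k)) {X : Set (Set ι)} (hX : IsUpperSet X) : IsUpperSet (osec e S X) :=
  fun _ _ hle hω => hX (plant_mono_right e S hle) hω

omit [Fintype ι] in
/-- Outer sections of an increasing event increase with the pattern. [this work] -/
theorem osec_mono (e : Fin k ↪ ι) {S T : Set (Fin k)} (h : S ⊆ T) {X : Set (Set ι)} (hX : IsUpperSet X) : osec e S X ⊆ osec e T X :=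
  fun ω hω => hX (plant_mono_left e h ω) hω

omit [Fintype ι] in
/-- Outer sections commute with intersection. [this work] -/
theorem osec_inter (e : Fin k ↪ ι) (S : Set (Fin k)) (X Y : Set (Set ι)) : osec e S (X ∩ Y) = osec e S X ∩ osec e S Y := rfl

omit [Fintype ι] in
/-- For an event determined by the block, membership of a planted configuration is membership of the pattern. [this work] -/
theorem plant_mem_iff (e : Fin k ↪ ι) {H : Set (Set ι)} (hH : DeterminedBy H (Set.range e)) (S : Set (Fin k)) (ω : Set ι) :
    plant e S ω ∈ H ↔ S ∈ pat e H := by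
  rw [mem_pat]
  refine (determinedBy_iff H _).1 hH _ _ ?_
  rw [plant_inter_range, Set.inter_eq_left.2 (Set.image_subset_range _ _)]

omit [Fintype ι] in
/-- The indicator of a block-determined event at a planted configuration. [this work] -/
theorem ind_plant (e : Fin k ↪ ι) {H : Set (Set ι)} (hH : DeterminedBy H (Set.range e)) (S : Set (Fin k)) (ω : Set ι) :
    ind H (plant e S ω) = ind (pat e H) S := by
  by_cases h : S ∈ pat e H
  · rw [ind_of_mem h, ind_of_mem ((plant_mem_iff e hH S ω).2 h)]
  · rw [ind_of_not_mem h, ind_of_not_mem (fun h' => h ((plant_mem_iff e hH S ω).1 h'))]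

omit [Fintype ι] in
/-- The pattern event of an increasing event is increasing. [this work] -/
theorem isUpperSet_pat (e : Fin k ↪ ι) {H : Set (Set ι)} (hH : IsUpperSet H) : IsUpperSet (pat e H) :=
  fun _ _ hle h => hH (Set.image_mono hle) h

/-! ### Block Fubini through the pattern cube -/

/-- The block as a `Finset`. [this work] -/
def blk (e : Fin k ↪ ι) : Finset ι := Finset.univ.map e

omit [Fintype ι] in
/-- Its coercion is `range e`. [this work] -/
theorem coe_blk (e : Fin k ↪ ι) : (↑(blk e) : Set ι) = Set.range e := by
  rw [blk, Finset.coe_map, Finset.coe_univ, Set.image_univ]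

omit [Fintype ι] in
/-- `plant` only depends on the block part of the planted configuration: planting `ζ`'s pattern is `Set.ite (range e) ζ`. [this work] -/
theorem plant_preimage (e : Fin k ↪ ι) (ζ ω : Set ι) : plant e (e ⁻¹' ζ) ω = Set.ite (Set.range e) ζ ω := by
  rw [plant, Set.image_preimage_eq_inter_range]
  simp only [Set.ite, Set.inter_assoc, Set.inter_self]

/-- The probability of a prescribed pattern on the block is the pattern's weight in the pattern cube. [this work] -/
theorem pr_preimage_eq (p : ι → unitInterval) (e : Fin k ↪ ι) (S : Set (Fin k)) :
    pr p {ζ | e ⁻¹' ζ = S} = bernoulliWeight (pk e p) S := by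
  have hset : {ζ : Set ι | e ⁻¹' ζ = S} = {ζ | ζ ∩ ↑(blk e) = (e '' S) ∩ ↑(blk e)} := by
    ext ζ
    simp only [Set.mem_setOf_eq, coe_blk]
    constructor
    · intro h; rw [← h, Set.image_preimage_eq_inter_range, Set.inter_assoc, Set.inter_self]
    · intro h
      have h2 : e ⁻¹' (ζ ∩ Set.range e) = e ⁻¹' ((e '' S) ∩ Set.range e) := by rw [h]
      rwa [Set.preimage_inter, Set.preimage_inter, Set.preimage_range, Set.inter_univ, Set.inter_univ,
        Set.preimage_image_eq _ e.injective] at h2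
  rw [hset, pr_cylinder, blk, Finset.prod_map]
  change ∏ i, (if e i ∈ e '' S then (p (e i) : ℝ) else 1 - (p (e i) : ℝ)) = ∏ i, (if i ∈ S then (p (e i) : ℝ) else 1 - (p (e i) : ℝ))
  exact Finset.prod_congr rfl fun i _ => by rw [e.injective.mem_set_image]

/-- **Block Fubini through the pattern cube**: `μ(X) = Σ_S w(S) · μ(osec_S X)`. [this work] -/
theorem pr_eq_sum_osec (p : ι → unitInterval) (e : Fin k ↪ ι) (X : Set (Set ι)) :
    pr p X = ∑ S : Set (Fin k), bernoulliWeight (pk e p) S * pr p (osec e S X) := by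
  -- step 1: through all block configurations ζ
  have hbf := blockFubini (fun x => (p x : ℝ)) (Set.range e) (fun x y : Set ι => ind X (x ∪ y))
  rw [show (∑ ω, weight (fun x => (p x : ℝ)) ω) = 1 from sum_bernoulliWeight p, one_mul] at hbf
  have hl : ∑ ω, weight (fun x => (p x : ℝ)) ω * ind X (ω ∩ Set.range e ∪ ω \ Set.range e) = pr p X := by
    rw [pr_eq_sum]; exact sum_congr rfl fun ω _ => by rw [Set.inter_union_sdiff]
  rw [hl] at hbf
  have h1 : pr p X = ∑ ζ, bernoulliWeight p ζ * pr p (osec e (e ⁻¹' ζ) X) := by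
    rw [hbf]
    refine sum_congr rfl fun ζ _ => ?_
    change bernoulliWeight p ζ * ∑ ω', bernoulliWeight p ω' * ind X (Set.ite (Set.range e) ζ ω') = _
    rw [pr_eq_sum]
    congr 1
    refine sum_congr rfl fun ω' _ => ?_
    congr 1
    have : (ω' ∈ osec e (e ⁻¹' ζ) X) ↔ Set.ite (Set.range e) ζ ω' ∈ X := by rw [mem_osec, plant_preimage]
    by_cases hm : Set.ite (Set.range e) ζ ω' ∈ X
    · rw [ind_of_mem hm, ind_of_mem (this.2 hm)]
    · rw [ind_of_not_mem hm, ind_of_not_mem (fun h' => hm (this.1 h'))]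
  -- step 2: regroup by pattern
  rw [h1, ← Finset.sum_fiberwise Finset.univ (fun ζ : Set ι => e ⁻¹' ζ)
    (fun ζ => bernoulliWeight p ζ * pr p (osec e (e ⁻¹' ζ) X))]
  refine sum_congr rfl fun S _ => ?_
  have hin : ∀ ζ ∈ Finset.univ.filter (fun ζ : Set ι => e ⁻¹' ζ = S),
      bernoulliWeight p ζ * pr p (osec e (e ⁻¹' ζ) X) = bernoulliWeight p ζ * pr p (osec e S X) := by
    intro ζ hζ; rw [(mem_filter.1 hζ).2]
  rw [sum_congr rfl hin, ← sum_mul]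
  congr 1
  rw [← pr_preimage_eq, pr_eq_sum, sum_filter]
  refine sum_congr rfl fun ζ _ => ?_
  by_cases h : e ⁻¹' ζ = S
  · rw [if_pos h, ind_of_mem (show ζ ∈ {ζ : Set ι | e ⁻¹' ζ = S} from h), mul_one]
  · rw [if_neg h, ind_of_not_mem (show ζ ∉ {ζ : Set ι | e ⁻¹' ζ = S} from h), mul_zero]

/-- Block Fubini for the intersection with the block-determined event: `μ(H ∩ X) = Σ_S w(S) 1_{H_k}(S) μ(osec_S X)`. [this work] -/
theorem pr_inter_eq_sum_osec (p : ι → unitInterval) (e : Fin k ↪ ι) {H : Set (Set ι)} (hH : DeterminedBy H (Set.range e))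
    (X : Set (Set ι)) :
    pr p (H ∩ X) = ∑ S : Set (Fin k), bernoulliWeight (pk e p) S * (ind (pat e H) S * pr p (osec e S X)) := by
  rw [pr_eq_sum_osec p e]
  refine sum_congr rfl fun S _ => ?_
  congr 1
  rw [osec_inter]
  by_cases h : S ∈ pat e H
  · have : osec e S H = Set.univ := Set.eq_univ_of_forall fun ω => (plant_mem_iff e hH S ω).2 h
    rw [this, Set.univ_inter, ind_of_mem h, one_mul]
  · have : osec e S H = ∅ := Set.eq_empty_of_forall_notMem fun ω hω => h ((plant_mem_iff e hH S ω).1 hω)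
    rw [this, Set.empty_inter, ind_of_not_mem h, zero_mul, pr_eq_sum]
    exact sum_eq_zero fun ω _ => by rw [ind_of_not_mem (Set.notMem_empty ω), mul_zero]

/-- The block-determined event itself: `μ(H) = w(H_k)`. [this work] -/
theorem pr_eq_pr_pat (p : ι → unitInterval) (e : Fin k ↪ ι) {H : Set (Set ι)} (hH : DeterminedBy H (Set.range e)) :
    pr p H = pr (pk e p) (pat e H) := by
  have h := pr_inter_eq_sum_osec p e hH Set.univ
  rw [Set.inter_univ] at h
  rw [h, pr_eq_sum]
  refine sum_congr rfl fun S _ => ?_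
  have : osec e S (Set.univ : Set (Set ι)) = Set.univ := Set.eq_univ_of_forall fun ω => Set.mem_univ _
  rw [this, pr_univ, mul_one]

/-! ### The outer sections of the two free slots -/

section Sections

variable (p : ι → unitInterval) (e : Fin k ↪ ι)

/-- `f(S) = μ(osec_S U)`. [this work] -/
def fsec (U : Set (Set ι)) (S : Set (Fin k)) : ℝ := pr p (osec e S U)

/-- The outer covariance `c(S) = μ(osec_S (U ∩ V)) − μ(osec_S U)μ(osec_S V)`. [this work] -/
def csec (U V : Set (Set ι)) (S : Set (Fin k)) : ℝ := fsec p e (U ∩ V) S - fsec p e U S * fsec p e V S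

/-- `f` is nonnegative. [this work] -/
theorem fsec_nonneg (U : Set (Set ι)) (S : Set (Fin k)) : 0 ≤ fsec p e U S := pr_nonneg p _

/-- `f` is increasing in the pattern for an increasing event. [this work] -/
theorem fsec_mono {U : Set (Set ι)} (hU : IsUpperSet U) : Monotone (fsec p e U) :=
  fun _ _ hle => pr_mono p (osec_mono e hle hU)

/-- The outer covariance is nonnegative (Harris outside the block). [this work] -/
theorem csec_nonneg {U V : Set (Set ι)} (hU : IsUpperSet U) (hV : IsUpperSet V) (S : Set (Fin k)) : 0 ≤ csec p e U V S := by
  unfold csec fsec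
  rw [osec_inter]
  exact cov_nonneg p (isUpperSet_osec e S hU) (isUpperSet_osec e S hV)

/-- The transport inequality for one pair of patterns: `c(S) ≤ c(T) + f(T)g(T) − f(S)g(S)` for `S ⊆ T`. [this work] -/
theorem csec_le {U V : Set (Set ι)} (hU : IsUpperSet U) (hV : IsUpperSet V) {S T : Set (Fin k)} (hST : S ⊆ T) :
    csec p e U V S ≤ csec p e U V T + (fsec p e U T * fsec p e V T - fsec p e U S * fsec p e V S) := by
  have hmono := fsec_mono p e (hU.inter hV) hST
  unfold csec
  linarith

end Sections

/-! ### The identity -/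

/-- Sahi's trilinear form on the pattern cube with first slot `1_{H_k}` and two pattern functions. [this work] -/
def cubeForm (q : Fin k → unitInterval) (Hk : Set (Set (Fin k))) (f g : Set (Fin k) → ℝ) : ℝ :=
  2 * (∑ S, bernoulliWeight q S * (ind Hk S * (f S * g S))) - pr q Hk * (∑ S, bernoulliWeight q S * (f S * g S))
    - (∑ S, bernoulliWeight q S * f S) * (∑ S, bernoulliWeight q S * (ind Hk S * g S))
    - (∑ S, bernoulliWeight q S * g S) * (∑ S, bernoulliWeight q S * (ind Hk S * f S))
    + pr q Hk * ((∑ S, bernoulliWeight q S * f S) * (∑ S, bernoulliWeight q S * g S))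

/-- **THE IDENTITY**: `E₃(1_H,1_U,1_V) = E₃^{cube}(1_{H_k}; f, g) + Σ_S w(S)(2·1_{H_k}(S) − θ)c(S)`. [this work] -/
theorem sahiE_three_eq_cubeForm_add (p : ι → unitInterval) (e : Fin k ↪ ι) {H : Set (Set ι)} (hH : DeterminedBy H (Set.range e))
    (U V : Set (Set ι)) :
    sahiE (bernoulliWeight p) 3 ![ind H, ind U, ind V] =
      cubeForm (pk e p) (pat e H) (fsec p e U) (fsec p e V)
        + ∑ S, bernoulliWeight (pk e p) S * ((2 * ind (pat e H) S - pr (pk e p) (pat e H)) * csec p e U V S) := by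
  have hprod : ∀ X Y : Set (Set ι), ind X * ind Y = ind (X ∩ Y) := fun X Y => funext fun ω => (ind_inter X Y ω).symm
  rw [sahiE_three]
  simp only [hprod]
  change 2 * pr p (H ∩ U ∩ V) + pr p H * pr p U * pr p V - (pr p H * pr p (U ∩ V) + pr p U * pr p (H ∩ V) + pr p V * pr p (H ∩ U)) = _
  rw [Set.inter_assoc, pr_inter_eq_sum_osec p e hH (U ∩ V), pr_inter_eq_sum_osec p e hH U, pr_inter_eq_sum_osec p e hH V,
    pr_eq_pr_pat p e hH, pr_eq_sum_osec p e U, pr_eq_sum_osec p e V, pr_eq_sum_osec p e (U ∩ V)]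
  unfold cubeForm csec fsec
  have h1 : ∑ S, bernoulliWeight (pk e p) S * (ind (pat e H) S * pr p (osec e S (U ∩ V))) =
      ∑ S, bernoulliWeight (pk e p) S * (ind (pat e H) S * (pr p (osec e S U) * pr p (osec e S V)))
        + ∑ S, bernoulliWeight (pk e p) S * (ind (pat e H) S *
            (pr p (osec e S (U ∩ V)) - pr p (osec e S U) * pr p (osec e S V))) := by
    rw [← sum_add_distrib]; exact sum_congr rfl fun S _ => by ring
  have h2 : ∑ S, bernoulliWeight (pk e p) S * pr p (osec e S (U ∩ V)) =
      ∑ S, bernoulliWeight (pk e p) S * (pr p (osec e S U) * pr p (osec e S V))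
        + ∑ S, bernoulliWeight (pk e p) S * (pr p (osec e S (U ∩ V)) - pr p (osec e S U) * pr p (osec e S V)) := by
    rw [← sum_add_distrib]; exact sum_congr rfl fun S _ => by ring
  have h3 : ∑ S, bernoulliWeight (pk e p) S * ((2 * ind (pat e H) S - pr (pk e p) (pat e H)) *
      (pr p (osec e S (U ∩ V)) - pr p (osec e S U) * pr p (osec e S V))) =
      2 * ∑ S, bernoulliWeight (pk e p) S * (ind (pat e H) S *
            (pr p (osec e S (U ∩ V)) - pr p (osec e S U) * pr p (osec e S V)))
        - pr (pk e p) (pat e H) * ∑ S, bernoulliWeight (pk e p) S *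
            (pr p (osec e S (U ∩ V)) - pr p (osec e S U) * pr p (osec e S V)) := by
    rw [mul_sum, mul_sum, ← sum_sub_distrib]; exact sum_congr rfl fun S _ => by ring
  rw [h1, h2, h3]
  ring

end SahiTransportCert

end Summit.CriticalPhenomena.PercolationContinuityZ3.Theorems
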